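import Summits.HodgeConjecture.HodgeConjecture.Theorems.K2E3WittLeviCartanRecursion
import Summits.HodgeConjecture.HodgeConjecture.Theorems.K2E3WittLeviCuspidalDichotomyOfCartan
import HarnessLib

/-!
# Levi Cartan decomposition, III-a: the cone × centre rewriting — label constancy, central diagonal elements of `M_S`, the cone element over `S`
# (crux H413, U12-g ∕ 13a road A, item (B) `hcartanLevi`)

Cell `hodgecm-mathlib`, Track B, line `K2_E3_EllipticInputs`, 13a road A; seat K2E3-p10 (g3).  THEOREMS ONLY; count-neutral helper.

Tools for rewriting a diagonal `diag(ϖ^E)` (`E` antitone on `S`-blocks, `E ∘ rev = −E`, ★ `K2E3WittLeviCartanRecursion`) as `(∏_{β ∈ S} a_β(ϖ)^{n β}) · z` with `z`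
CENTRAL in `M_S = ↥(wittLevi σ W e S)` (`W = wittFormOn e Han = J₀`, standard `e`):

* §1 `mem_of_wittBlockNat_inl_eq`, `mem_of_wittBlockNat_inl_eq_card`, `wittBlockNat_inl_le_card` — equal labels of `e`-indices mean no break in between;
* §2 `wittBlockOn_rev` (mirror labels), **`mem_center_wittLevi_of_diagonal`** (a diagonal element with exponent constant on `S`-blocks is central in `M_S`),
  `coe_noncommProd_levi` + `prod_levi_coweight_pow_eq_zpow` (the cone element over `S` is `diag(ϖ^G)` with `G(e_t) = Σ_{β ∈ S, t ≤ β} n β`, middle `0`, mirror `−`),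
  `sum_cone_step` (`G` steps down by `n_t` across `t ∈ S`), and **`const_on_blocks_of_steps`** (a function with these steps, `0` on the middle block, antisymmetric,
  is constant on the `S`-blocks).

The sequel `K2E3WittLeviCartanUnramified` assembles `hcartanLevi(S)` and `dichM(S)`.

References: A. Borel (1991), §23; I. N. Bernstein, A. V. Zelevinsky (1977), §2.1, §2.4; F. Bruhat, J. Tits (1972), (4.4.3).
-/

set_option autoImplicit false
set_option linter.dupNamespace false

noncomputable section

open scoped Valued WithZero Matrix MatrixGroups
open Matrix

namespace Summit.HodgeConjecture.HodgeConjecture.Cruxes.H413.K2E3WittLeviConeCentre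

open Literature.NumberTheory.Automorphic Literature.NumberTheory.Automorphic.UnitaryGroup Literature.NumberTheory.Automorphic.HermitianLattice
open K2E3LocalUnitaryWitt K2E3WittStandardIndexing K2E3WittConeContraction K2E3WittCartanUnramified K2E3WittLeviCuspidalDichotomyOfCartan
  K2E3WittLeviCartanBlocks K2E3WittLeviCartanLabels K2E3WittLeviCartanRecursion

/-! ## §1 Label combinatorics of the `e`-indices -/

section Labels

variable {r m : ℕ} (S : Finset (Fin r))

/-- **Equal labels of `e_t ≤ e_{t'}` ⇒ no break in `[t, t')`.** [cite: Borel1991, §23] -/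
theorem mem_of_wittBlockNat_inl_eq {t t' : Fin r} (htt' : t ≤ t')
    (h : wittBlockNat (m := m) S (Sum.inl t) = wittBlockNat (m := m) S (Sum.inl t')) (u : Fin r) (hu1 : t ≤ u) (hu2 : u < t') : u ∈ S := by
  by_contra hS
  change ((Finset.univ \ S).filter fun α => α.val < t.val).card = ((Finset.univ \ S).filter fun α => α.val < t'.val).card at h
  refine (Finset.card_lt_card (Finset.ssubset_iff_subset_ne.2 ⟨fun α hα => ?_, fun hAB => ?_⟩)).ne h
  · simp only [Finset.mem_filter] at hα ⊢
    exact ⟨hα.1, lt_of_lt_of_le hα.2 (Fin.le_iff_val_le_val.1 htt')⟩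
  · have hu : u ∈ (Finset.univ \ S).filter fun α : Fin r => α.val < t'.val := by
      simp only [Finset.mem_filter, Finset.mem_sdiff, Finset.mem_univ, true_and]
      exact ⟨hS, Fin.lt_def.1 hu2⟩
    rw [← hAB] at hu
    simp only [Finset.mem_filter] at hu
    exact absurd hu.2 (not_lt.2 (Fin.le_iff_val_le_val.1 hu1))

/-- `label(e_t) ≤ L = #(univ ∖ S)`. [cite: Borel1991, §23] -/
theorem wittBlockNat_inl_le_card (t : Fin r) : wittBlockNat (m := m) S (Sum.inl t) ≤ (Finset.univ \ S).card :=
  Finset.card_filter_le _ _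

/-- **Label `L` on `e_t` ⇒ no break `≥ t`.** [cite: Borel1991, §23] -/
theorem mem_of_wittBlockNat_inl_eq_card {t : Fin r} (h : wittBlockNat (m := m) S (Sum.inl t) = (Finset.univ \ S).card) (u : Fin r)
    (hu : t ≤ u) : u ∈ S := by
  by_contra hS
  change ((Finset.univ \ S).filter fun α => α.val < t.val).card = (Finset.univ \ S).card at h
  rw [Finset.card_filter_eq_iff] at h
  have := h u (by simp [hS])
  exact absurd this (not_lt.2 (Fin.le_iff_val_le_val.1 hu))

end Labels

/-! ## §2 The unitary group side: mirror labels, central diagonal elements, the cone element over `S` -/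

section Group

variable {K : Type*} [Field K] (σ : K →+* K) {N r m : ℕ} (e : WittIndex r m ≃ Fin N) (Han : Matrix (Fin m) (Fin m) K) (S : Finset (Fin r))

/-- **Mirror labels**: for `W = J₀` (`hW`), `label(rev k) = rev (label k)` (the Witt form is anti-block, ★ `wittBlockOn_eq_rev_of_wittFormOn_ne_zero`; `W_{k, rev k} = 1`).
[cite: Borel1991, §23] -/
theorem wittBlockOn_rev (hW : wittFormOn e Han = (StdForm.antidiagonal N).over K) (k : Fin N) :
    wittBlockOn e S (Fin.rev k) = Fin.rev (wittBlockOn e S k) := by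
  refine wittBlockOn_eq_rev_of_wittFormOn_ne_zero e S Han k (Fin.rev k) ?_
  rw [hW, antidiagonal_over_apply, if_pos rfl]
  exact one_ne_zero

/-- **A diagonal element of `U(σ, W)` whose exponent is constant on the `S`-blocks is CENTRAL in `M_S`** (`(m d)_{ij} = m_{ij} ϖ^{d_j}`, `(d m)_{ij} = ϖ^{d_i} m_{ij}`,
and `m_{ij} ≠ 0 ⇒` equal labels). [cite: BernsteinZelevinsky1977, §2.1] [cite: Borel1991, §23] -/
theorem mem_center_wittLevi_of_diagonal {ϖ : K} (d : Fin N → ℤ) (z : ↥(wittLevi σ (wittFormOn e Han) e S))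
    (hz : (((z : ↥(unitaryGroupOfForm σ (wittFormOn e Han))) : GL (Fin N) K) : Matrix (Fin N) (Fin N) K) = Matrix.diagonal fun k => ϖ ^ d k)
    (hd : ∀ i j, wittBlockOn e S i = wittBlockOn e S j → d i = d j) : z ∈ Subgroup.center ↥(wittLevi σ (wittFormOn e Han) e S) := by
  rw [Subgroup.mem_center_iff]
  intro g
  have hg := (mem_wittLevi_iff (g : ↥(unitaryGroupOfForm σ (wittFormOn e Han)))).1 g.2
  rw [mem_standardLeviGL_iff] at hg
  refine Subtype.ext (Subtype.ext (Units.ext (Matrix.ext fun i j => ?_)))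
  change ((((g : ↥(unitaryGroupOfForm σ (wittFormOn e Han))) : GL (Fin N) K) : Matrix (Fin N) (Fin N) K) *
      (((z : ↥(unitaryGroupOfForm σ (wittFormOn e Han))) : GL (Fin N) K) : Matrix (Fin N) (Fin N) K)) i j =
    ((((z : ↥(unitaryGroupOfForm σ (wittFormOn e Han))) : GL (Fin N) K) : Matrix (Fin N) (Fin N) K) *
      (((g : ↥(unitaryGroupOfForm σ (wittFormOn e Han))) : GL (Fin N) K) : Matrix (Fin N) (Fin N) K)) i j
  rw [hz, Matrix.mul_diagonal, Matrix.diagonal_mul]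
  by_cases hij : wittBlockOn e S i = wittBlockOn e S j
  · rw [hd i j hij, mul_comm]
  · rw [hg i j hij, mul_zero, zero_mul]

/-- **The cone element over `S` is diagonal**: the matrix of `∏_{β ∈ S} a_β(ϖ)^{n β}` (product in `M_S`) is `diagonal (k ↦ ∏_{β ∈ S} wittCoweight_β(ϖ)(e⁻¹k)^{n β})`.
[cite: Borel1991, §23] -/
theorem coe_noncommProd_levi (hσ : ∀ a, σ (σ a) = a) (ϖ : Kˣ) (n : ↥S → ℕ) :
    ((((Finset.univ.noncommProd (fun β : ↥S => (⟨wittCocharacter σ hσ e Han β ϖ, wittCocharacter_mem_wittLevi σ hσ e Han β ϖ S⟩ :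
        ↥(wittLevi σ (wittFormOn e Han) e S)) ^ n β) (fun β _ β' _ _ => (commute_wittCocharacter_levi σ hσ e Han β β' ϖ S).pow_pow (n β) (n β')) :
          ↥(wittLevi σ (wittFormOn e Han) e S)) : ↥(unitaryGroupOfForm σ (wittFormOn e Han))) : GL (Fin N) K) : Matrix (Fin N) (Fin N) K) =
      Matrix.diagonal fun k => ∏ β : ↥S, ((wittCoweight σ (β : Fin r) ϖ (e.symm k) : Kˣ) : K) ^ n β := by
  set ψ : ↥(wittLevi σ (wittFormOn e Han) e S) →* Matrix (Fin N) (Fin N) K :=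
    ((Units.coeHom (Matrix (Fin N) (Fin N) K)).comp (unitaryGroupOfForm σ (wittFormOn e Han)).subtype).comp (wittLevi σ (wittFormOn e Han) e S).subtype
    with hψ
  have hψapp : ∀ x : ↥(wittLevi σ (wittFormOn e Han) e S),
      ((((x : ↥(unitaryGroupOfForm σ (wittFormOn e Han))) : GL (Fin N) K) : Matrix (Fin N) (Fin N) K)) = ψ x := fun x => rfl
  set v : ↥S → Fin N → K := fun β k => ((wittCoweight σ (β : Fin r) ϖ (e.symm k) : Kˣ) : K) ^ n β with hv
  have hfac : ∀ β ∈ (Finset.univ : Finset ↥S), ψ ((⟨wittCocharacter σ hσ e Han β ϖ, wittCocharacter_mem_wittLevi σ hσ e Han β ϖ S⟩ :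
      ↥(wittLevi σ (wittFormOn e Han) e S)) ^ n β) = Matrix.diagonalRingHom (Fin N) K (v β) := fun β _ => by
    rw [map_pow, ← hψapp]
    change (((wittCocharacter σ hσ e Han β ϖ : ↥(unitaryGroupOfForm σ (wittFormOn e Han))) : GL (Fin N) K) : Matrix (Fin N) (Fin N) K) ^ n β = _
    rw [coe_wittCocharacter, coe_wittCocharacterGL, Matrix.diagonal_pow]
    rfl
  rw [hψapp, Finset.map_noncommProd, Finset.noncommProd_congr rfl hfac, ← Finset.map_noncommProd _ _ (fun _ _ _ _ _ => Commute.all _ _),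
    Finset.noncommProd_eq_prod, Matrix.diagonalRingHom_apply]
  congr 1
  funext k
  rw [Finset.prod_apply]

/-- **Entrywise value of the cone element over `S`** (`σ ϖ = ϖ`, standard `e`): `e_t ↦ ϖ^{Σ_{β ∈ S, t ≤ β} n β}`, middle `↦ ϖ^0`,
`f`-slot `j ↦ ϖ^{−Σ_{β ∈ S, rev j ≤ β} n β}`. [cite: Borel1991, §23] -/
theorem prod_levi_coweight_pow_eq_zpow {ϖ : K} (hϖ0 : ϖ ≠ 0) (hσϖ : σ ϖ = ϖ) (n : ↥S → ℕ) (k : Fin N) :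
    (∏ β : ↥S, ((wittCoweight (m := m) σ (β : Fin r) (Units.mk0 ϖ hϖ0) (e.symm k) : Kˣ) : K) ^ n β) =
      ϖ ^ (Sum.elim (fun t : Fin r => ((∑ β : ↥S, if t.val ≤ (β : Fin r).val then n β else 0 : ℕ) : ℤ))
        (Sum.elim (fun _ : Fin m => (0 : ℤ)) (fun j : Fin r => -((∑ β : ↥S, if (Fin.rev j).val ≤ (β : Fin r).val then n β else 0 : ℕ) : ℤ)))
        (e.symm k)) := by
  have hσu : Units.map (σ : K →* K) (Units.mk0 ϖ hϖ0) = Units.mk0 ϖ hϖ0 := Units.ext (by simp [hσϖ])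
  rcases e.symm k with t | u | j
  · simp only [Sum.elim_inl]
    have h1 : (∏ β : ↥S, ((wittCoweight (m := m) σ (β : Fin r) (Units.mk0 ϖ hϖ0) (Sum.inl t) : Kˣ) : K) ^ n β) =
        ∏ β : ↥S, ϖ ^ (if t.val ≤ (β : Fin r).val then n β else 0) := by
      refine Finset.prod_congr rfl fun β _ => ?_
      rw [wittCoweight_inl]
      split_ifs
      · rfl
      · rw [Units.val_one, one_pow, pow_zero]
    rw [h1, Finset.prod_pow_eq_pow_sum, ← zpow_natCast]
  · simp only [Sum.elim_inr, Sum.elim_inl, zpow_zero]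
    exact Finset.prod_eq_one fun β _ => by rw [wittCoweight_inr_inl, Units.val_one, one_pow]
  · simp only [Sum.elim_inr]
    have h1 : (∏ β : ↥S, ((wittCoweight (m := m) σ (β : Fin r) (Units.mk0 ϖ hϖ0) (Sum.inr (Sum.inr j)) : Kˣ) : K) ^ n β) =
        ∏ β : ↥S, ϖ⁻¹ ^ (if (Fin.rev j).val ≤ (β : Fin r).val then n β else 0) := by
      refine Finset.prod_congr rfl fun β _ => ?_
      rw [wittCoweight_inr_inr, hσu]
      split_ifs
      · rw [Units.val_inv_eq_inv_val, Units.val_mk0]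
      · rw [Units.val_one, one_pow, pow_zero]
    rw [h1, Finset.prod_pow_eq_pow_sum, inv_pow, ← zpow_natCast, _root_.zpow_neg]

/-- The cone exponent steps down by `n ⟨t⟩` across `t ∈ S` and is unchanged across `t ∉ S`:
`Σ_{β ∈ S, t ≤ β} n β = [t ∈ S] n t + Σ_{β ∈ S, t+1 ≤ β} n β`. [cite: Borel1991, §23] -/
theorem sum_cone_step (n : ↥S → ℕ) (t : ℕ) (ht : t < r) :
    (∑ β : ↥S, if t ≤ (β : Fin r).val then n β else 0) =
      (if h : (⟨t, ht⟩ : Fin r) ∈ S then n ⟨⟨t, ht⟩, h⟩ else 0) + ∑ β : ↥S, if t + 1 ≤ (β : Fin r).val then n β else 0 := by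
  have hsplit : ∀ β : ↥S, (if t ≤ (β : Fin r).val then n β else 0) =
      (if (β : Fin r) = ⟨t, ht⟩ then n β else 0) + (if t + 1 ≤ (β : Fin r).val then n β else 0) := fun β => by
    by_cases h1 : (β : Fin r) = ⟨t, ht⟩
    · have : (β : Fin r).val = t := by rw [h1]
      rw [if_pos (by omega), if_pos h1, if_neg (by omega), add_zero]
    · have : (β : Fin r).val ≠ t := fun h => h1 (Fin.ext h)
      by_cases h2 : t ≤ (β : Fin r).val
      · rw [if_pos h2, if_neg h1, if_pos (by omega), zero_add]
      · rw [if_neg h2, if_neg h1, if_neg (by omega)]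
  rw [Finset.sum_congr rfl fun β _ => hsplit β, Finset.sum_add_distrib]
  congr 1
  by_cases h : (⟨t, ht⟩ : Fin r) ∈ S
  · rw [dif_pos h, Finset.sum_eq_single (⟨⟨t, ht⟩, h⟩ : ↥S)]
    · rw [if_pos rfl]
    · intro β _ hβ; rw [if_neg]; exact fun h' => hβ (Subtype.ext h')
    · intro h'; exact absurd (Finset.mem_univ _) h'
  · rw [dif_neg h]
    exact Finset.sum_eq_zero fun β _ => if_neg fun h' => h (by rw [← h']; exact β.2)

/-- **Block constancy from steps**: a function `F : Fin N → ℤ` with `F(e_t) = F(e_{t+1})` across every `t ∈ S`, `F(e_{r-1}) = 0` if `r - 1 ∈ S`, `F = 0` on the middle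
block and `F ∘ rev = -F` is CONSTANT ON THE `S`-BLOCKS (`W = J₀`, standard `e`, `m ≤ 1`). [cite: Borel1991, §23] [cite: BernsteinZelevinsky1977, §2.1] -/
theorem const_on_blocks_of_steps
    (hstd : ∀ x, (e x).val = Sum.elim (fun i : Fin r => i.val) (Sum.elim (fun u : Fin m => r + u.val) (fun j : Fin r => r + m + j.val)) x)
    (hW : wittFormOn e Han = (StdForm.antidiagonal N).over K) (F : Fin N → ℤ)
    (h1 : ∀ (t : ℕ) (ht : t + 1 < r), (⟨t, by omega⟩ : Fin r) ∈ S → F (e (Sum.inl ⟨t, by omega⟩)) = F (e (Sum.inl ⟨t + 1, ht⟩)))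
    (h2 : ∀ (hr : 0 < r), (⟨r - 1, by omega⟩ : Fin r) ∈ S → F (e (Sum.inl ⟨r - 1, by omega⟩)) = 0)
    (h3 : ∀ u : Fin m, F (e (Sum.inr (Sum.inl u))) = 0) (h4 : ∀ k, F (Fin.rev k) = -F k) :
    ∀ i j : Fin N, wittBlockOn e S i = wittBlockOn e S j → F i = F j := by
  -- `e`-indices with equal labels
  have hee : ∀ t t' : Fin r, t ≤ t' → wittBlockNat (m := m) S (Sum.inl t) = wittBlockNat (m := m) S (Sum.inl t') →
      F (e (Sum.inl t)) = F (e (Sum.inl t')) := by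
    intro t t' htt' hlab
    have hS := mem_of_wittBlockNat_inl_eq (m := m) S htt' hlab
    -- induction on the distance
    have key : ∀ d : ℕ, ∀ (a : ℕ) (ha : a + d < r), t.val ≤ a → a + d ≤ t'.val →
        F (e (Sum.inl ⟨a, by omega⟩)) = F (e (Sum.inl ⟨a + d, ha⟩)) := by
      intro d
      induction d with
      | zero => intro a ha _ _; rfl
      | succ d ih =>
        intro a ha h1a h2a
        rw [ih a (by omega) h1a (by omega)]
        have := h1 (a + d) (by omega) (hS ⟨a + d, by omega⟩ (Fin.le_iff_val_le_val.2 (by simp; omega)) (Fin.lt_def.2 (by simp; omega)))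
        rw [this]
        rfl
    have := key (t'.val - t.val) t.val (by have := t'.isLt; have := Fin.le_iff_val_le_val.1 htt'; omega) le_rfl
      (by have := Fin.le_iff_val_le_val.1 htt'; omega)
    have ht : (⟨t.val, by omega⟩ : Fin r) = t := Fin.ext rfl
    have ht' : (⟨t.val + (t'.val - t.val), by have := t'.isLt; have := Fin.le_iff_val_le_val.1 htt'; omega⟩ : Fin r) = t' :=
      Fin.ext (by have := Fin.le_iff_val_le_val.1 htt'; change t.val + (t'.val - t.val) = t'.val; omega)
    rw [ht, ht'] at this
    exact this
  -- `e`-indices with the middle label `L`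
  have heL : ∀ t : Fin r, wittBlockNat (m := m) S (Sum.inl t) = (Finset.univ \ S).card → F (e (Sum.inl t)) = 0 := by
    intro t hlab
    have hS := mem_of_wittBlockNat_inl_eq_card (m := m) S hlab
    have hr : 0 < r := Fin.pos t
    have hlast : wittBlockNat (m := m) S (Sum.inl ⟨r - 1, by omega⟩) = (Finset.univ \ S).card := by
      refine le_antisymm (wittBlockNat_inl_le_card (m := m) S _) ?_
      rw [← hlab]
      exact wittBlockNat_mono_pos S (by change t.val ≤ r - 1; have := t.isLt; omega)
    rw [hee t ⟨r - 1, by omega⟩ (Fin.le_iff_val_le_val.2 (by have := t.isLt; change t.val ≤ r - 1; omega)) (hlab.trans hlast.symm)]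
    exact h2 hr (hS _ (Fin.le_iff_val_le_val.2 (by have := t.isLt; change t.val ≤ r - 1; omega)))
  -- labels as naturals; mirror
  have hval : ∀ k : Fin N, (wittBlockOn e S k).val = wittBlockNat S (e.symm k) := fun k => rfl
  have hrev : ∀ k : Fin N, (wittBlockOn e S (Fin.rev k)).val = 2 * (Finset.univ \ S).card - (wittBlockOn e S k).val := fun k => by
    rw [wittBlockOn_rev e Han S hW k, Fin.val_rev]; omega
  have hmidL : ∀ u : Fin m, wittBlockNat (m := m) S (Sum.inr (Sum.inl u)) = (Finset.univ \ S).card := fun u => rfl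
  have heLe : ∀ t : Fin r, wittBlockNat (m := m) S (Sum.inl t) ≤ (Finset.univ \ S).card := fun t => wittBlockNat_inl_le_card S t
  -- `f`-slot `j` is the mirror of `e_{rev j}`
  have hf : ∀ j : Fin r, e (Sum.inr (Sum.inr j)) = Fin.rev (e (Sum.inl (Fin.rev j))) := fun j => by
    rw [rev_apply_inl e hstd, Fin.rev_rev]
  intro i j hij
  obtain ⟨x, rfl⟩ := e.surjective i
  obtain ⟨y, rfl⟩ := e.surjective j
  have hijv := congrArg Fin.val hij
  rw [hval, hval, e.symm_apply_apply, e.symm_apply_apply] at hijv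
  rcases x with t | u | jx <;> rcases y with t' | u' | jy
  · rcases le_total t t' with h | h
    · exact hee t t' h hijv
    · exact (hee t' t h hijv.symm).symm
  · rw [hmidL] at hijv; rw [heL t hijv, h3]
  · -- `e_t` vs `f_{jy}`: both labels are `L`
    have h' := hrev (e (Sum.inl (Fin.rev jy)))
    rw [← hf, hval, hval, e.symm_apply_apply, e.symm_apply_apply] at h'
    have hLt : wittBlockNat (m := m) S (Sum.inl t) = (Finset.univ \ S).card := by
      have := heLe t; have := heLe (Fin.rev jy); omega
    have hLj : wittBlockNat (m := m) S (Sum.inl (Fin.rev jy)) = (Finset.univ \ S).card := by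
      have := heLe t; have := heLe (Fin.rev jy); omega
    rw [heL t hLt, hf, h4, heL _ hLj, neg_zero]
  · rw [hmidL] at hijv; rw [heL t' hijv.symm, h3]
  · rw [h3, h3]
  · have h' := hrev (e (Sum.inl (Fin.rev jy)))
    rw [← hf, hval, hval, e.symm_apply_apply, e.symm_apply_apply] at h'
    rw [hmidL] at hijv
    have hLj : wittBlockNat (m := m) S (Sum.inl (Fin.rev jy)) = (Finset.univ \ S).card := by
      have := heLe (Fin.rev jy); omega
    rw [h3, hf, h4, heL _ hLj, neg_zero]
  · have h' := hrev (e (Sum.inl (Fin.rev jx)))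
    rw [← hf, hval, hval, e.symm_apply_apply, e.symm_apply_apply] at h'
    have hLt : wittBlockNat (m := m) S (Sum.inl t') = (Finset.univ \ S).card := by
      have := heLe t'; have := heLe (Fin.rev jx); omega
    have hLj : wittBlockNat (m := m) S (Sum.inl (Fin.rev jx)) = (Finset.univ \ S).card := by
      have := heLe t'; have := heLe (Fin.rev jx); omega
    rw [heL t' hLt, hf, h4, heL _ hLj, neg_zero]
  · have h' := hrev (e (Sum.inl (Fin.rev jx)))
    rw [← hf, hval, hval, e.symm_apply_apply, e.symm_apply_apply] at h'
    rw [hmidL] at hijv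
    have hLj : wittBlockNat (m := m) S (Sum.inl (Fin.rev jx)) = (Finset.univ \ S).card := by
      have := heLe (Fin.rev jx); omega
    rw [h3, hf, h4, heL _ hLj, neg_zero]
  · -- two `f`-slots: mirror of two `e`-indices
    have hx' := hrev (e (Sum.inl (Fin.rev jx)))
    have hy' := hrev (e (Sum.inl (Fin.rev jy)))
    rw [← hf, hval, hval, e.symm_apply_apply, e.symm_apply_apply] at hx' hy'
    have hlab : wittBlockNat (m := m) S (Sum.inl (Fin.rev jx)) = wittBlockNat (m := m) S (Sum.inl (Fin.rev jy)) := by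
      have := heLe (Fin.rev jx); have := heLe (Fin.rev jy); omega
    rw [hf jx, hf jy, h4, h4]
    rcases le_total (Fin.rev jx) (Fin.rev jy) with h | h
    · rw [hee _ _ h hlab]
    · rw [hee _ _ h hlab.symm]

end Group

end Summit.HodgeConjecture.HodgeConjecture.Cruxes.H413.K2E3WittLeviConeCentre

end
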